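import Literature.AlgebraicGeometry.ShimuraVarieties.UnitaryShimuraCurveEmbeddingComplex
import Literature.AlgebraicGeometry.Morphisms.CofanOfClosedCoverLift
import Literature.AlgebraicGeometry.Morphisms.ClopenPieceOfCoproduct
import Literature.AlgebraicGeometry.Motives.RelativePeriods
import Literature.AlgebraicGeometry.HodgeTheory.ComplexPointsLifting
import Literature.NumberTheory.Transcendental.AnalytificationCoordinateHolomorphyTransport
import HarnessLib

/-!
# Pieces and uniformisation of the DESCENDED unitary Shimura curve (road (ii), leaf L3.6 F-COFAN):
# `(M⋆_{K⋆})_τ ≅ ∐ Z_{q,i}` over the special curves of the surface pieces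

Topic `AlgebraicGeometry/ShimuraVarieties`, namespace `…ShimuraVarieties.UnitaryCanonicalModel`. THEOREMS ONLY (no definition,
no named fact, no instance, no `sorry`).  Cell `hodgecm-mathlib`, road (ii) «embedded-curve descent» of the census «GS-3 ⇐ #62»
(A-p10 g7 CUT memo `CUT-R2-5-FIELDS`, leaf L3.6); books 0.

SETTING (one surface level `K`, one curve level `K⋆` with `φGS(K⋆) ≤ K`, everything as HYPOTHESES so that the leaf does not
wait on its neighbours).  The SURFACE record `R` with its complex pieces `(X_q, unif_q, g_q)_q` (a colimit cofan of
`(M_K)_τ`, ★ `RecordSystem.pieces`); the DESCENDED curve level `M⋆ ↪ M_K` over `L` (`j`, a closed immersion with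
`(M⋆)_τ` reduced — ★ `RecordSystem.exists_descendedTower`) with its complex points `(M⋆)(ℂ) ≃ₜ Sh_{K⋆}(U(J⋆))(ℂ)` read
through `j` as ★ `ShimuraSetGS.embPoints` (leaf L3.4); and finitely many CLOSED special curves `κ_r : Z_r ↪ X_{q′(r)}` of the
surface pieces, reduced, uniformised by disc data `B⋆_r` (`unif⋆_r`, ★ `exists_specialCurveDatum`) intertwined with the
surface pieces along the frames `γ_r B` (`κ_r(ℂ)(unif⋆_r v) = unif_{q′(r)}((γ_r B)^τ(v ⊕ 0))`, bookkeepers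
`g_{q′(r)}⁻¹ γ_{r,f} φGS(g⋆_r) ∈ K`), whose images in `(M_K)_τ` are pairwise disjoint and exhaust the image of `(M⋆)_τ`
(leaves L3.2 F-IMG / L3.3 F-REIDX / F-INJ at an injective level).

RESULTS.
* `exists_cofan_pieces_of_specialCurves` — the `κ_r` LIFT to closed immersions `ι⋆_r : Z_r ⟶ (M⋆)_τ` which form a COLIMIT
  cofan, `(M⋆)_τ ≅ ∐_r Z_r` (★ `Morphisms.exists_lift_isColimit_cofan_of_closed_cover`: a reduced scheme set-theoretically the
  disjoint union of finitely many closed subschemes is their coproduct), and the uniformisations read through the curve's points: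
  `ι⋆_r(ℂ)(unif⋆_r v) = pts⋆⁻¹ [v, g⋆_r K⋆]` — the third clause of the `pieces` field of ★ `RecordSystemGS` for `M⋆`
  (★ `map_piece_unif_frameEmbNeg_eq_embPoints` + injectivity of `j(ℂ)`);
* `exists_unif_differentiableOn_of_cofan_pieces` — the `hol` field of ★ `RecordSystemGS` for `M⋆`: for every `a`,
  `v ↦ pts⋆⁻¹ [v, aK⋆]` is holomorphic in the algebraic coordinates of `(M⋆)_τ` on the negative cone of `J⋆^τ` — move `a` to the
  representative of its class (★ `ShimuraSetGS.mk_eq_mk_mulVec_rep`) and push the disc datum's `differentiableOn_unif` along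
  `ι⋆_r` (★ `differentiableOn_evalOrZero_map_comp`).

NOT here: the level junction `B⋆_r.Γ^{τ₁} = Γ_{J⋆}(g⋆_r K⋆ g⋆_r⁻¹)^τ` (frame / trace-level bookkeeping, leaf L3.3 + ★
`exists_smallLevelFunctor_comap_φGS_eq`), smoothness/projectivity (L3.5 ★ `SmoothOfRelativeDimensionCofanDescent`), points and
reciprocity (L3.4), the head GS-3″ (L3.7).

## References
* [Deligne1979ShimuraVarieties] P. Deligne, *Variétés de Shimura* (1979), 2.1.2–2.1.4 (the pieces `Γ_g∖X⁺` of `Sh_K(ℂ)`).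
* [Milne2005ShimuraVarieties] J. S. Milne, *Introduction to Shimura varieties* (2005/2017), Lemma 5.13 p. 57, Thm. 13.6 p. 118.
* [Liu2021] Y. Liu, Camb. J. Math. 9 (2021), proof of Thm. 4.15 (FJcycle.tex l. 2193–2208).
* [GortzWedhorn2020] U. Görtz, T. Wedhorn, *Algebraic Geometry I* (2nd ed. 2020), §(3.5) Prop. 3.10 / Ex. 3.11, Prop. 4.32.
* [SerreGAGA1956] J.-P. Serre, *GAGA* (1956), §2 n°5.
-/

set_option autoImplicit false

noncomputable section

open Function MulAction Topology NumberField IsDedekindDomain CategoryTheory CategoryTheory.Limits Matrix AlgebraicGeometry Set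
open scoped Matrix ComplexOrder
open Literature.AlgebraicGeometry.Motives
open Literature.AlgebraicGeometry.Morphisms (exists_lift_isColimit_cofan_of_closed_cover isColimit_cofan_left
  isClopen_range_of_isColimit_cofan isOpenImmersion_of_isColimit_cofan)
open Literature.NumberTheory.Automorphic Literature.NumberTheory.Automorphic.UnitaryGroup
open Literature.NumberTheory.Automorphic.Liu2021.AppendixC (C5.OpenCompactSubgroup C5.SmallLevel)
open Literature.Geometry.ComplexHyperbolic Literature.Geometry.ComplexHyperbolic.BallModel
open Literature.NumberTheory.Transcendental (differentiableOn_evalOrZero_map_comp)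

namespace Literature.AlgebraicGeometry.ShimuraVarieties.UnitaryCanonicalModel

variable {L : Type} [Field L] [NumberField L] [IsCMField L] {Jstar : Matrix (Fin 2) (Fin 2) L} {τ : L →+* ℂ}
  {K₀ : C5.OpenCompactSubgroup ↥(finAdelic (↥(maximalRealSubfield L)) L (IsCMField.complexConj L) 2 Jstar)}
  {H : Matrix (Fin 3) (Fin 3) L} {T : GL (Fin 3) ℂ} {hT : formCongr (starRingEnd ℂ) T (H.map τ) = BallModel.J}
  {K₀' : C5.OpenCompactSubgroup ↥(finAdelic (↥(maximalRealSubfield L)) L (IsCMField.complexConj L) 3 H)}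

/-! ### §1. Plumbing: injectivity on points of a closed immersion; legs of a coproduct are closed immersions -/

omit [NumberField L] [IsCMField L] in
/-- A morphism of `L`-schemes which is a monomorphism on underlying schemes (e.g. a closed immersion) is injective on `L′`-points.
[folklore] -/
private theorem map_injective_of_mono' {L' : Type} [Field L'] [Algebra L L'] {X Y : SchemeOver L} (ι : X ⟶ Y) [Mono ι.left] :
    Function.Injective (AlgPoints.map (L := L') ι) := by
  intro Q Q' h
  ext : 1
  rw [← cancel_mono ι.left]
  exact congrArg (fun P : AlgPoints Y L' => P.left) h

omit [NumberField L] [IsCMField L] in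
/-- The legs of a colimit cofan of `ℂ`-schemes are closed immersions (open immersions with closed image).
[cite: GortzWedhorn2020, §(3.5) Prop. 3.10 and Example 3.11] -/
private theorem isClosedImmersion_leg_of_isColimit {Ξ : Type} {X : Ξ → SchemeOver ℂ} {S : SchemeOver ℂ}
    {ι : ∀ q, X q ⟶ S} (hcol : IsColimit (Cofan.mk S ι)) (q : Ξ) : IsClosedImmersion (ι q).left := by
  obtain ⟨hcl⟩ := isColimit_cofan_left hcol
  haveI : IsOpenImmersion (ι q).left := isOpenImmersion_of_isColimit_cofan hcl q
  exact IsClosedImmersion.of_isPreimmersion _ (isClopen_range_of_isColimit_cofan hcl q).1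

/-! ### §2. The cofan of lifted special curves and its uniformisation clause -/

section Pieces

variable (R : RecordSystem L H τ T hT K₀')
  (Jperp : Matrix (Fin 1) (Fin 1) L) (B : GL (Fin 3) L) {a : L} (ha : a ≠ 0)
  (hB : formCongr ((IsCMField.complexConj L : L ≃ₐ[↥(maximalRealSubfield L)] L) : L →+* L) B (a • H) = finSum 2 1 Jstar Jperp)
  (hτa : 0 < (τ a).re) (hτa' : (τ a).im = 0)
  {Kstar : C5.SmallLevel K₀} {K : C5.SmallLevel K₀'} (hK : Kstar.1.1.map (φGS L Jstar Jperp H B ha hB) ≤ K.1.1)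

/-- **L3.6 F-COFAN — the complex fibre of the descended curve is the coproduct of the lifted special curves, uniformised through
the curve's Shimura set.**  With the setting of the module docstring (surface pieces `(X_q, unif_q, g_q)`; closed special curves
`κ_r : Z_r ↪ X_{q′(r)}` with disc data `B⋆_r`, frames `γ_r B`, bookkeepers `γ_r`; the descended level `j : M⋆ ↪ M_K`, `(M⋆)_τ`
reduced, with points `pts⋆` read through `j` as `embPoints`; the images `κ_r(Z_r) ⊆ (M_K)_τ` pairwise disjoint and exhausting the
image of `(M⋆)_τ`): there are closed immersions `ι⋆_r : Z_r ⟶ (M⋆)_τ` over `κ_r` forming a COLIMIT cofan, and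
`ι⋆_r(ℂ)(unif⋆_r v) = pts⋆⁻¹[v, g⋆_r K⋆]` for every negative `v` — the `pieces` clause of ★ `RecordSystemGS` for the descended
tower, modulo the level junction. [cite: Deligne1979ShimuraVarieties, 2.1.2–2.1.4] [cite: Milne2005ShimuraVarieties, Lemma 5.13 p. 57 and Thm. 13.6 p. 118]
[cite: GortzWedhorn2020, §(3.5) Prop. 3.10, Prop. 4.32] -/
theorem exists_cofan_pieces_of_specialCurves
    -- the surface pieces at level `K`
    {Ξ : Type} {X : Ξ → SchemeOver ℂ} (ι : ∀ q, X q ⟶ (Motives.baseChangeHom τ).obj (R.M.obj K))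
    (hcol : IsColimit (Cofan.mk ((Motives.baseChangeHom τ).obj (R.M.obj K)) ι))
    (Bq : ∀ q, UnitaryBallUniformisationDatum 2 (X q))
    (gq : Ξ → finAdelic (↥(maximalRealSubfield L)) L (IsCMField.complexConj L) 3 H)
    (hBq : ∀ q, (Bq q).Hℂ = H.map τ)
    (hιq : letI : Algebra L ℂ := τ.toAlgebra
      ∀ q (x : Ball), AlgPoints.map (L := ℂ) (ι q) ((Bq q).unif ((T : Matrix (Fin 3) (Fin 3) ℂ) *ᵥ BallModel.lift x)) =
        AlgPoints.baseChangeEquiv τ (R.M.obj K) ((R.pts K).symm (ShimuraSet.mk L H τ T hT K.1.1 x (gq q))))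
    -- the special curves of the surface pieces, with their disc data and bookkeepers
    {Ξs : Type} [Finite Ξs] (gs : Ξs → ↥(finAdelic (↥(maximalRealSubfield L)) L (IsCMField.complexConj L) 2 Jstar))
    (q' : Ξs → Ξ) (γ : Ξs → ↥(rational (↥(maximalRealSubfield L)) L (IsCMField.complexConj L) 3 H))
    (hγ : ∀ r, (gq (q' r))⁻¹ * (rationalToFinAdelic (↥(maximalRealSubfield L)) L (IsCMField.complexConj L) 3 H (γ r) *
      φGS L Jstar Jperp H B ha hB (gs r)) ∈ K.1.1)
    {Z : Ξs → SchemeOver ℂ} [∀ r, IsReduced (Z r).left] (κ : ∀ r, Z r ⟶ X (q' r)) [∀ r, IsClosedImmersion (κ r).left]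
    (Bs : ∀ r, UnitaryBallUniformisationDatum 1 (Z r))
    (hf : ∀ r, ∀ v ∈ negCone (Jstar.map τ),
      AlgPoints.map (κ r) ((Bs r).unif v) = (Bq (q' r)).unif (frameEmbNeg τ ((γ r : GL (Fin 3) L) * B) v))
    -- the descended level and its complex points
    {Mst : SchemeOver L} (j : Mst ⟶ R.M.obj K) [IsClosedImmersion j.left]
    (hred : IsReduced ((Motives.baseChangeHom τ).obj Mst).left)
    (ptss : letI : Algebra L ℂ := τ.toAlgebra; ComplexPoints Mst ≃ₜ ShimuraSetGS L Jstar τ Kstar.1.1)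
    (hpts : letI : Algebra L ℂ := τ.toAlgebra
      ∀ P, AlgPoints.map j (ptss.symm P) =
        (R.pts K).symm (ShimuraSetGS.embPoints L H τ T hT Jstar Jperp B ha hB hτa hτa' Kstar.1.1 K.1.1 hK P))
    -- disjointness and exhaustion of the special curves inside the image of the descended level
    (hdisj : Pairwise (Disjoint on fun r => Set.range ⇑(κ r ≫ ι (q' r)).left))
    (hcov : ⋃ r, Set.range ⇑(κ r ≫ ι (q' r)).left = Set.range ⇑((Motives.baseChangeHom τ).map j).left) :
    letI : Algebra L ℂ := τ.toAlgebra
    ∃ ιs : ∀ r, Z r ⟶ (Motives.baseChangeHom τ).obj Mst,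
      (∀ r, ιs r ≫ (Motives.baseChangeHom τ).map j = κ r ≫ ι (q' r)) ∧
      (∀ r, IsClosedImmersion (ιs r).left) ∧
      Nonempty (IsColimit (Cofan.mk ((Motives.baseChangeHom τ).obj Mst) ιs)) ∧
      ∀ r (v : Fin 2 → ℂ) (hv : v ∈ negCone (Jstar.map τ)),
        AlgPoints.map (ιs r) ((Bs r).unif v) =
          AlgPoints.baseChangeEquiv τ Mst (ptss.symm (ShimuraSetGS.mk L Jstar τ Kstar.1.1 v hv (gs r))) := by
  letI : Algebra L ℂ := τ.toAlgebra
  -- the closed immersions `κ_r ≫ ι_{q′(r)}` and `j_τ`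
  haveI : ∀ q, IsClosedImmersion (ι q).left := isClosedImmersion_leg_of_isColimit hcol
  haveI : ∀ r, IsClosedImmersion (κ r ≫ ι (q' r)).left := fun r => by
    rw [Over.comp_left]; infer_instance
  haveI : IsClosedImmersion ((Motives.baseChangeHom τ).map j).left := SchemePair.isClosedImmersion_baseChangeHom_map_left τ j
  haveI := hred
  -- LIFT + COLIMIT
  obtain ⟨ιs, hιs, hcl, hcolim⟩ :=
    exists_lift_isColimit_cofan_of_closed_cover ((Motives.baseChangeHom τ).map j) (fun r => κ r ≫ ι (q' r)) hdisj hcov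
  refine ⟨ιs, hιs, hcl, hcolim, fun r v hv => ?_⟩
  -- the uniformisation clause, checked after the injective `j_τ(ℂ)`
  apply map_injective_of_mono' ((Motives.baseChangeHom τ).map j)
  rw [← AlgPoints.map_comp_apply, hιs r, AlgPoints.map_comp_apply, hf r v hv,
    map_piece_unif_frameEmbNeg_eq_embPoints R Jperp B ha hB hτa hτa' hK (Bq (q' r)) (gq (q' r)) (gs r) (γ r) (hBq (q' r))
      (ι (q' r)) (hιq (q' r)) (hγ r) v hv,
    ← HodgeTheory.baseChangeEquiv_map j, hpts]

end Pieces

/-! ### §3. The uniformisation of the descended level is holomorphic in algebraic coordinates -/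

section Hol

variable {Kstar : Subgroup ↥(finAdelic (↥(maximalRealSubfield L)) L (IsCMField.complexConj L) 2 Jstar)}

/-- **L3.6 F-COFAN, `hol` clause — `v ↦ pts⋆⁻¹[v, aK⋆]` is holomorphic in the algebraic coordinates of `(M⋆)_τ`** for EVERY
`a ∈ U(J⋆)(𝔸_{L⁺,f})`: with lifted pieces `ι⋆_r : Z_r ⟶ (M⋆)_τ` uniformised as `ι⋆_r(ℂ)(unif⋆_r v) = pts⋆⁻¹[v, g⋆_r K⋆]` (§2)
and representatives exhausting the classes (`hgs`), move `a` to its representative `[v, aK⋆] = [δ^τ v, g⋆_r K⋆]` (★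
`ShimuraSetGS.mk_eq_mk_mulVec_rep`) and push the disc datum's holomorphy `differentiableOn_unif` along `ι⋆_r` (★
`differentiableOn_evalOrZero_map_comp`) — the `hol` field of ★ `RecordSystemGS` at this level.
[cite: Deligne1979ShimuraVarieties, 2.1.2–2.1.4] [cite: SerreGAGA1956, §2 n°5] -/
theorem exists_unif_differentiableOn_of_cofan_pieces {Mst : SchemeOver L}
    (ptss : letI : Algebra L ℂ := τ.toAlgebra; ComplexPoints Mst ≃ₜ ShimuraSetGS L Jstar τ Kstar)
    {Ξs : Type} (gs : Ξs → ↥(finAdelic (↥(maximalRealSubfield L)) L (IsCMField.complexConj L) 2 Jstar))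
    (hgs : ∀ u : ↥(finAdelic (↥(maximalRealSubfield L)) L (IsCMField.complexConj L) 2 Jstar),
      ∃ (r : Ξs) (δ : ↥(rational (↥(maximalRealSubfield L)) L (IsCMField.complexConj L) 2 Jstar)),
        (rationalToFinAdelic (↥(maximalRealSubfield L)) L (IsCMField.complexConj L) 2 Jstar δ * u)⁻¹ * gs r ∈ Kstar)
    {Z : Ξs → SchemeOver ℂ} (Bs : ∀ r, UnitaryBallUniformisationDatum 1 (Z r)) (hBs : ∀ r, (Bs r).Hℂ = Jstar.map τ)
    (ιs : letI : Algebra L ℂ := τ.toAlgebra; ∀ r, Z r ⟶ (Motives.baseChangeHom τ).obj Mst)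
    (hunif : letI : Algebra L ℂ := τ.toAlgebra
      ∀ r (v : Fin 2 → ℂ) (hv : v ∈ negCone (Jstar.map τ)),
        AlgPoints.map (ιs r) ((Bs r).unif v) =
          AlgPoints.baseChangeEquiv τ Mst (ptss.symm (ShimuraSetGS.mk L Jstar τ Kstar v hv (gs r))))
    (a : ↥(finAdelic (↥(maximalRealSubfield L)) L (IsCMField.complexConj L) 2 Jstar)) :
    letI : Algebra L ℂ := τ.toAlgebra
    ∃ u : (Fin 2 → ℂ) → ComplexPoints ((Motives.baseChangeHom τ).obj Mst),
      (∀ (v : Fin 2 → ℂ) (hv : v ∈ negCone (Jstar.map τ)),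
          u v = AlgPoints.baseChangeEquiv τ Mst (ptss.symm (ShimuraSetGS.mk L Jstar τ Kstar v hv a))) ∧
        ∀ (U : ((Motives.baseChangeHom τ).obj Mst).left.affineOpens)
          (f : ((Motives.baseChangeHom τ).obj Mst).left.presheaf.obj
            (Opposite.op (↑U : ((Motives.baseChangeHom τ).obj Mst).left.Opens))),
          DifferentiableOn ℂ
            (fun v ↦ AlgPoints.evalOrZero (↑U : ((Motives.baseChangeHom τ).obj Mst).left.Opens) f (u v))
            (negCone (Jstar.map τ) ∩ u ⁻¹' {P | P.pt ∈ (↑U : ((Motives.baseChangeHom τ).obj Mst).left.Opens)}) := by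
  letI : Algebra L ℂ := τ.toAlgebra
  -- the representative of the class of `a`
  refine (hgs a).elim fun r hr => hr.elim fun δ hδ => ?_
  -- `u = ι⋆_r(ℂ) ∘ unif⋆_r ∘ δ^τ`
  set u₀ : (Fin 2 → ℂ) → ComplexPoints (Z r) :=
    fun v => (Bs r).unif (((ratToGLℂ L Jstar τ δ : GL (Fin 2) ℂ) : Matrix (Fin 2) (Fin 2) ℂ) *ᵥ v) with hu₀
  have hlin : Differentiable ℂ fun v : Fin 2 → ℂ => ((ratToGLℂ L Jstar τ δ : GL (Fin 2) ℂ) : Matrix (Fin 2) (Fin 2) ℂ) *ᵥ v :=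
    (LinearMap.toContinuousLinearMap
      (Matrix.mulVecLin (((ratToGLℂ L Jstar τ δ : GL (Fin 2) ℂ) : Matrix (Fin 2) (Fin 2) ℂ)))).differentiable
  have hcone : ∀ {v : Fin 2 → ℂ}, v ∈ negCone (Jstar.map τ) →
      ((ratToGLℂ L Jstar τ δ : GL (Fin 2) ℂ) : Matrix (Fin 2) (Fin 2) ℂ) *ᵥ v ∈ (Bs r).cone := fun {v} hv => by
    have h := smul_ratToGLℂ_mulVec_mem_negCone (L := L) (Jstar := Jstar) (τ := τ) δ one_ne_zero hv
    rw [one_smul] at h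
    change _ ∈ negCone (Bs r).Hℂ; rw [hBs r]; exact h
  refine ⟨AlgPoints.map (ιs r) ∘ u₀, fun v hv => ?_, fun U f => ?_⟩
  · -- the formula: `[v, aK⋆] = [δ^τ v, g⋆_r K⋆]`
    have hx : ((ratToGLℂ L Jstar τ δ : GL (Fin 2) ℂ) : Matrix (Fin 2) (Fin 2) ℂ) *ᵥ v ∈ negCone (Jstar.map τ) := by
      have h := hcone hv; change _ ∈ negCone (Bs r).Hℂ at h; rwa [hBs r] at h
    rw [Function.comp_apply, hu₀, hunif r _ hx, ShimuraSetGS.mk_eq_mk_mulVec_rep v hv a (gs r) δ hδ hx]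
  · -- holomorphy pushed along `ι⋆_r`
    refine differentiableOn_evalOrZero_map_comp (isOpen_negCone _) ?_ ?_ (ιs r) U f
    · exact (Bs r).continuousOn_unif.comp hlin.continuous.continuousOn fun v hv => hcone hv
    · intro V s
      have hd := (Bs r).differentiableOn_unif V s
      refine (hd.comp hlin.differentiableOn fun v hv => ⟨hcone hv.1, hv.2⟩)

end Hol

end Literature.AlgebraicGeometry.ShimuraVarieties.UnitaryCanonicalModel

end
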